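import Mathlib
import Literature.MathematicalPhysics.QuantumFieldTheory.Balaban1983to89.B5FiberDelta

/-!
# B5 p. 30: «The configuration ∂*A is orthogonal to constant functions» — and `Δ`, `∂_ν^*`
# preserve that subspace (the domain sentence of (1.70))

Source: T. Bałaban, *Propagators and renormalization transformations for lattice gauge
theories. I*, Commun. Math. Phys. 95 (1984) 17–40 (`Balaban1984PropagatorsI`, "B5"), renders
`b2b-balaban-ref1/pages/1984-cmp95-propagators-rt-I/…-pNNN-x2.png` (PDF page = journal page − 16),
read as images.

## What the paper prints (verbatim)

* p. 30 [PDF 14], before (1.70): «The configuration ∂*A is orthogonal to constant functions and on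
  such configurations the operator P is given by the formula P = Δ⁻¹Q′*(Q′Δ⁻²Q′*)⁻¹Q′Δ⁻¹. (1.70)».
* p. 21 [PDF 5], after (1.21), in printed order: «where Δ is η-lattice Laplace operator for scalar
  functions and ∂* is the divergence operator for vector functions, ∂*A = Σ_μ ∂*_μA_μ.»
  (DOCFIX after cross-read G-pv10-8: the first version of this header spliced the two clauses of this
  sentence in reversed order inside one quotation.)

## What is typed and certified here (kernel-checked, zero sorry)

With pass 7's position-space operators on a torus `Tor N` with lattice factor `c` (`sdiff` = ∂_ν,
`divS`/`(GradOp)ᴴ` = ∂*, `LapS` = Δ) and pass 4's unitary DFT `dft`: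
* `sum_shift_sub` — translation invariance of `Σ_x`;
* `sum_sdiffH`, `sum_divS`, `sum_GradOp_adjoint` — `Σ_x (∂_ν^* g)(x) = 0`, `Σ_x (∂*A)(x) = 0`;
* `divS_orth_const` — THE PRINTED SENTENCE: `⟨a·1, ∂*A⟩ = 0` for every constant `a`;
* `dft_divS_zero` — its momentum form `(∂*A)^(0) = 0`;
* `sum_LapS`, `LapS_orth_const` — `Δ` maps every scalar function into the orthogonal complement of
  the constants («on such configurations»: the subspace on which `Δ⁻¹` of (1.70) is taken is
  preserved by `Δ`).

## What is NOT certified here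

The operator `P` of (1.70) in position space and the invertibility of `Δ` / `Q′Δ⁻²Q′*` on that
subspace (fiberwise this is pass 5, `B5Prop11Inverse.Pproj`); fields complex.
-/

open scoped BigOperators Matrix ComplexConjugate
open Finset Complex

namespace Literature.MathematicalPhysics.QuantumFieldTheory.Balaban1983to89.B5DivOrth

open Literature.MathematicalPhysics.QuantumFieldTheory.Balaban1983to89.B5Prop11Plancherel
open Literature.MathematicalPhysics.QuantumFieldTheory.Balaban1983to89.B5Action121
open Literature.MathematicalPhysics.QuantumFieldTheory.Balaban1983to89.B5Block118

noncomputable section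

variable {d : ℕ} (N : Fin d → ℕ) [hN : ∀ μ, NeZero (N μ)]

/-- translation invariance of the sum over the torus: `Σ_x g(x − v) = Σ_x g(x)`. [folklore] -/
theorem sum_shift_sub (g : Tor N → ℂ) (v : Tor N) : ∑ x, g (x - v) = ∑ x, g x :=
  Fintype.sum_equiv (Equiv.subRight v) _ _ (fun _ => rfl)

/-- `Σ_x (∂_ν^* g)(x) = 0`. [folklore] -/
theorem sum_sdiffH (c : ℂ) (ν : Fin d) (g : Tor N → ℂ) :
    ∑ x, ((sdiff N c ν)ᴴ *ᵥ g) x = 0 := by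
  simp only [sdiff_conjTranspose_mulVec]
  rw [← Finset.mul_sum, Finset.sum_sub_distrib, sum_shift_sub N g (unitVec N ν),
    sub_self, mul_zero]

/-- `Σ_x (∂*A)(x) = 0`: the divergence of any vector field sums to zero over the torus.
[cite: Balaban1984PropagatorsI, (1.70) p.30] -/
theorem sum_divS (c : ℂ) (A : Tor N × Fin d → ℂ) : ∑ x, divS N c A x = 0 := by
  simp only [divS, Finset.sum_apply]
  rw [Finset.sum_comm]
  exact Finset.sum_eq_zero fun μ _ => sum_sdiffH N c μ _

/-- the same for `(∂)ᴴ A` (pass 7: `(GradOp)ᴴ A = ∂*A`). [folklore] -/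
theorem sum_GradOp_adjoint (c : ℂ) (A : Tor N × Fin d → ℂ) :
    ∑ x, ((GradOp N c)ᴴ *ᵥ A) x = 0 := by
  rw [GradOp_conjTranspose_mulVec_eq, sum_divS]

/-- p. 30: «The configuration ∂*A is orthogonal to constant functions»: `⟨a, ∂*A⟩ = 0` for every
constant function `a`. [cite: Balaban1984PropagatorsI, (1.70) p.30] -/
theorem divS_orth_const (c a : ℂ) (A : Tor N × Fin d → ℂ) :
    star (fun _ : Tor N => a) ⬝ᵥ divS N c A = 0 := by
  simp only [dotProduct, Pi.star_apply]
  rw [← Finset.mul_sum, sum_divS, mul_zero]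

/-- momentum form: `(∂*A)^(0) = 0` (the zero mode of a divergence vanishes).
[cite: Balaban1984PropagatorsI, (1.70) p.30] -/
theorem dft_divS_zero (c : ℂ) (A : Tor N × Fin d → ℂ) : (dft N *ᵥ divS N c A) 0 = 0 := by
  simp only [Matrix.mulVec, dotProduct, dft_apply', chi_zero_left, map_one, mul_one]
  rw [← Finset.mul_sum, sum_divS, mul_zero]

/-- `Σ_x (Δ f)(x) = 0`: `Δ = Σ_ν ∂_ν^*∂_ν` maps into the orthogonal complement of the constants.
[cite: Balaban1984PropagatorsI, (1.70) p.30] -/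
theorem sum_LapS (c : ℂ) (f : Tor N → ℂ) : ∑ x, (LapS N c *ᵥ f) x = 0 := by
  simp only [LapS, Matrix.sum_mulVec, Finset.sum_apply, ← Matrix.mulVec_mulVec]
  rw [Finset.sum_comm]
  exact Finset.sum_eq_zero fun ν _ => sum_sdiffH N c ν _

/-- reading of «on such configurations» (not a printed assertion; cross-read G-pv10-8, advisory A1):
`⟨a, Δ f⟩ = 0` — the subspace orthogonal to constants, on which the `Δ⁻¹` of (1.70) is taken, is
preserved by `Δ`. [folklore] -/
theorem LapS_orth_const (c a : ℂ) (f : Tor N → ℂ) :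
    star (fun _ : Tor N => a) ⬝ᵥ (LapS N c *ᵥ f) = 0 := by
  simp only [dotProduct, Pi.star_apply]
  rw [← Finset.mul_sum, sum_LapS, mul_zero]

end

end Literature.MathematicalPhysics.QuantumFieldTheory.Balaban1983to89.B5DivOrth
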